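import Literature.Analysis.FunctionSpaces.HerglotzTheorem
import HarnessLib

/-!
# Stripe-order kernels: Bragg weights of a representing measure, the multi-atom cosine-kernel ceiling,
# and the two M3 designs

HONEST FRAMING: first certified bounds; not a superconductivity verdict; every number certified or labelled float.

Speedrun `mbsolver`, seat sr-mbsolver-m3-4 (M3 canonical-point team, stripe observables), gen 8.  Pure
harmonic analysis + explicit design arithmetic; zero compute; no state, no named fact, no sorry.  Companion:
`Observables/StripeOrderKernelCeiling.lean` turns the CERTIFIED functional rows #258/#262 (`G_c`) and
#259/#263 (`G_s`) into Bragg-weight ceilings using this file.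

## §1 (any dimension `d`)

* `braggSet Q = Q + 2πℤᵈ ⊆ ℝᵈ`; `braggWeight μ Q := (μ (⋃ⱼ braggSet (Q j))).toReal` for a finite family of
  wavevectors `Q j` (e.g. a point-group star).
* The REPRESENTATION HYPOTHESIS used throughout, `∀ r, ∫ exp (i r·ξ) dμ(ξ) = C r` for a finite measure `μ`
  on `ℝᵈ` and a lattice function `C : ℤᵈ → ℂ`, is literally the conclusion of Herglotz's theorem
  `Literature.Analysis.FunctionSpaces.IsPositiveDefinite.exists_measure_integral_exp_eq`; such a `μ` exists
  iff `C` is positive definite (`exists_representing_iff_isPositiveDefinite`).  For `C` the correlation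
  function of a translation-invariant lattice state, `braggWeight μ ![Q]` is the squared long-range-order
  parameter at wavevector `Q` (Wiener: the box Cesàro means of `e^{-iQ·r} C(r)` converge to `μ(Q + 2πℤᵈ)`;
  that identification is words here, not a theorem of this file).
* `cosKernel r k ξ = Σₗ kₗ cos(rₗ·ξ)` and the **multi-atom kernel ceiling** (`kernelCeiling_braggWeight_le`):
  if `K = cosKernel r k ≥ 0` pointwise and `K (Q j) = κ` for all `j`, then
  `κ · braggWeight μ Q ≤ Σₗ kₗ · Re C(rₗ)` — a finite window sum of `C`.  (Unshifted and for several atoms at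
  once; the shifted single-atom twin is pub-mbboot-lit's staged `Transport.kernel_ceiling_of_integral_exp_eq`,
  whose integration pattern is reused here.)  Trivial comparison: `braggWeight μ Q ≤ Re C(0)`.

## §2 (the square lattice, `d = 2`): the two M3 designs of HOME/sr-mbsolver-m3-4/lro/LRO-CEILING.md §3

* CHARGE: `K̄_c = cosKernel chargeTapVec chargeTapWt = 17/36 + (cos ξ₁ + cos ξ₂)/6 ≥ 5/36` (the
  D₄-symmetrised autocorrelation of the gen-6 taps `f₀ = 1/2, f_{e₁} = (1 − i)/3`), constant
  `= 23/36 + √2/12 ≥ 0.75674` on the charge-stripe star `chargeStar = {(±π/4, 0), (0, ±π/4)}` (`δ = 1/8`,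
  period-8 charge stripes).
* SPIN: `K_s = cosKernel spinTapVec spinTapWt = ¼(1 − cos ξ₁)(1 − cos ξ₂) ≥ 0` (staggered plaquette taps
  `±1/4`), constant `= (1 + cos(π/8))/2 ≥ 0.9619397` on the spin-stripe star
  `spinStar = {(±7π/8, π), (π, ±7π/8)}` (period-16 spin stripes) and `= 1` at `(π, π)`.

Nothing in this file refers to a Hamiltonian or a state.
-/

noncomputable section

namespace Summit.Ventures.CertifiedManyBodySolver.Observables

open MeasureTheory Complex Filter Topology
open scoped Real BigOperators

/-! ### §1. Bragg sets, cosine kernels, and the multi-atom kernel ceiling (any dimension) -/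

section General

variable {d : ℕ}

/-- The set of frequencies congruent to `Q` modulo `2πℤᵈ`, as a subset of `ℝᵈ`
(the support of the Bragg peak at wavevector `Q` of a measure representing a lattice function). -/
def braggSet (Q : Fin d → ℝ) : Set (EuclideanSpace ℝ (Fin d)) :=
  {ξ | ∃ m : Fin d → ℤ, ∀ i, ξ i = Q i + 2 * π * m i}

/-- `Q + 2πℤᵈ` is measurable (a countable union of points). -/
theorem measurableSet_braggSet (Q : Fin d → ℝ) : MeasurableSet (braggSet Q) := by
  have hAeq : braggSet Q = ⋃ m : Fin d → ℤ,
      (fun ξ : EuclideanSpace ℝ (Fin d) => fun i => ξ i) ⁻¹' {fun i => Q i + 2 * π * m i} := by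
    ext ξ
    simp only [braggSet, Set.mem_setOf_eq, Set.mem_iUnion, Set.mem_preimage, Set.mem_singleton_iff,
      funext_iff]
  rw [hAeq]
  refine MeasurableSet.iUnion fun m => ?_
  exact (measurable_pi_lambda _ fun i => by fun_prop) (measurableSet_singleton _)

/-- The **Bragg weight** of a finite family of wavevectors `Q j`: the `μ`-mass of `⋃ⱼ (Q j + 2πℤᵈ)`,
as a real number.  For `μ` representing the correlation function of a translation-invariant state this is
the total squared order parameter carried by the wavevectors `Q j` (e.g. a point-group star). -/
def braggWeight (μ : Measure (EuclideanSpace ℝ (Fin d))) {n : ℕ} (Q : Fin n → (Fin d → ℝ)) : ℝ :=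
  (μ (⋃ j, braggSet (Q j))).toReal

/-- Bragg weights are nonnegative. -/
theorem braggWeight_nonneg (μ : Measure (EuclideanSpace ℝ (Fin d))) {n : ℕ}
    (Q : Fin n → (Fin d → ℝ)) : 0 ≤ braggWeight μ Q :=
  ENNReal.toReal_nonneg

/-- A cosine-polynomial kernel with finitely many taps: `K(ξ) = Σₗ kₗ cos(rₗ·ξ)`, `rₗ ∈ ℤᵈ`, `kₗ ∈ ℝ`
(taps indexed by `Fin m`; repetitions allowed). -/
def cosKernel {m : ℕ} (r : Fin m → (Fin d → ℤ)) (k : Fin m → ℝ) (ξ : Fin d → ℝ) : ℝ :=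
  ∑ l, k l * Real.cos (∑ i, (r l i : ℝ) * ξ i)

/-- A cosine kernel is continuous on `ℝᵈ`. -/
theorem cosKernel_continuous {m : ℕ} (r : Fin m → (Fin d → ℤ)) (k : Fin m → ℝ) :
    Continuous (fun ξ : EuclideanSpace ℝ (Fin d) => cosKernel r k (fun i => ξ i)) := by
  unfold cosKernel
  fun_prop

/-- A cosine kernel is bounded by the `ℓ¹` norm of its weights. -/
theorem abs_cosKernel_le {m : ℕ} (r : Fin m → (Fin d → ℤ)) (k : Fin m → ℝ) (ξ : Fin d → ℝ) :
    |cosKernel r k ξ| ≤ ∑ l, |k l| := by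
  unfold cosKernel
  refine (Finset.abs_sum_le_sum_abs _ _).trans (Finset.sum_le_sum fun l _ => ?_)
  rw [abs_mul]
  exact mul_le_of_le_one_right (abs_nonneg _) (Real.abs_cos_le_one _)

/-- `2π`-periodicity: on `Q + 2πℤᵈ` the kernel takes the value `K(Q)`. -/
theorem cosKernel_eq_of_mem_braggSet {m : ℕ} (r : Fin m → (Fin d → ℤ)) (k : Fin m → ℝ)
    {Q : Fin d → ℝ} {ξ : EuclideanSpace ℝ (Fin d)} (hξ : ξ ∈ braggSet Q) :
    cosKernel r k (fun i => ξ i) = cosKernel r k Q := by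
  obtain ⟨mv, hm⟩ := hξ
  unfold cosKernel
  refine Finset.sum_congr rfl fun l _ => ?_
  have : (∑ i, (r l i : ℝ) * ξ i) = (∑ i, (r l i : ℝ) * Q i) + ((∑ i, r l i * mv i : ℤ) : ℝ) * (2 * π) := by
    push_cast
    rw [Finset.sum_mul, ← Finset.sum_add_distrib]
    exact Finset.sum_congr rfl fun i _ => by rw [hm i]; ring
  rw [this, Real.cos_add_int_mul_two_pi]

variable {C : (Fin d → ℤ) → ℂ} (μ : Measure (EuclideanSpace ℝ (Fin d))) [IsFiniteMeasure μ]

/-- For a representing measure, `∫ cos(r·ξ) dμ = Re C(r)`. -/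
theorem integral_cos_eq_re
    (hμ : ∀ r : Fin d → ℤ, ∫ ξ, exp ((∑ i, (r i : ℝ) * ξ i : ℝ) * I) ∂μ = C r)
    (r : Fin d → ℤ) :
    ∫ ξ, Real.cos (∑ i, (r i : ℝ) * ξ i) ∂μ = (C r).re := by
  have hcont : Continuous fun ξ : EuclideanSpace ℝ (Fin d) => (∑ i, (r i : ℝ) * ξ i : ℝ) := by
    fun_prop
  have hexp_int : Integrable (fun ξ : EuclideanSpace ℝ (Fin d) =>
      exp ((∑ i, (r i : ℝ) * ξ i : ℝ) * I)) μ := by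
    refine Integrable.mono' (integrable_const (1 : ℝ)) ?_ (ae_of_all _ fun ξ => ?_)
    · exact (Complex.continuous_exp.comp
        ((Complex.continuous_ofReal.comp hcont).mul continuous_const)).aestronglyMeasurable
    · rw [Complex.norm_exp_ofReal_mul_I]
  rw [← hμ r]
  have h := integral_re hexp_int
  simp only [RCLike.re_to_complex] at h
  rw [← h]
  refine integral_congr_ae (ae_of_all _ fun ξ => ?_)
  simp only [Complex.exp_ofReal_mul_I_re]

/-- `∫ K dμ = Σₗ kₗ · Re C(rₗ)` for a cosine kernel and a representing measure. -/
theorem integral_cosKernel_eq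
    (hμ : ∀ r : Fin d → ℤ, ∫ ξ, exp ((∑ i, (r i : ℝ) * ξ i : ℝ) * I) ∂μ = C r)
    {m : ℕ} (r : Fin m → (Fin d → ℤ)) (k : Fin m → ℝ) :
    ∫ ξ, cosKernel r k (fun i => ξ i) ∂μ = ∑ l, k l * (C (r l)).re := by
  unfold cosKernel
  rw [integral_finsetSum _ (fun l _ => ?_)]
  · refine Finset.sum_congr rfl fun l _ => ?_
    rw [integral_const_mul, integral_cos_eq_re μ hμ (r l)]
  · refine (Integrable.mono' (integrable_const (1 : ℝ)) ?_ (ae_of_all _ fun ξ => ?_)).const_mul _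
    · exact (Real.continuous_cos.comp (by fun_prop)).aestronglyMeasurable
    · simpa using Real.abs_cos_le_one _

/-- **Multi-atom kernel ceiling.**  Let `μ` be a finite measure on `ℝᵈ` representing `C : ℤᵈ → ℂ`,
`K(ξ) = Σₗ kₗ cos(rₗ·ξ)` a pointwise NONNEGATIVE cosine kernel, and `Q₁,…,Qₙ` wavevectors at each of
which `K` takes the same value `κ`.  Then

  `κ · μ(⋃ⱼ (Qⱼ + 2πℤᵈ)) ≤ Σₗ kₗ · Re C(rₗ)`.

Proof: `K = κ` on the union (periodicity), so `κ·μ(⋃) = ∫_⋃ K dμ ≤ ∫ K dμ` by `K ≥ 0`.  With a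
point-group-symmetric kernel and `Q` a star this bounds the TOTAL Bragg weight of the star by one finite
window sum of `C`. -/
theorem kernelCeiling_braggWeight_le
    (hμ : ∀ r : Fin d → ℤ, ∫ ξ, exp ((∑ i, (r i : ℝ) * ξ i : ℝ) * I) ∂μ = C r)
    {m : ℕ} (r : Fin m → (Fin d → ℤ)) (k : Fin m → ℝ) (hK : ∀ p : Fin d → ℝ, 0 ≤ cosKernel r k p)
    {n : ℕ} (Q : Fin n → (Fin d → ℝ)) (κ : ℝ) (hκ : ∀ j, cosKernel r k (Q j) = κ) :
    κ * braggWeight μ Q ≤ ∑ l, k l * (C (r l)).re := by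
  set A : Set (EuclideanSpace ℝ (Fin d)) := ⋃ j, braggSet (Q j) with hA
  set K : EuclideanSpace ℝ (Fin d) → ℝ := fun ξ => cosKernel r k (fun i => ξ i) with hKdef
  have hKnn : ∀ ξ, 0 ≤ K ξ := fun ξ => hK _
  have hKcont : Continuous K := cosKernel_continuous r k
  have hKint : Integrable K μ :=
    Integrable.mono' (integrable_const _) hKcont.aestronglyMeasurable
      (ae_of_all _ fun ξ => by simpa [Real.norm_eq_abs] using abs_cosKernel_le r k (fun i => ξ i))
  have hKA : ∀ ξ ∈ A, K ξ = κ := by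
    intro ξ hξ
    rw [hA, Set.mem_iUnion] at hξ
    obtain ⟨j, hj⟩ := hξ
    rw [hKdef]
    dsimp only
    rw [cosKernel_eq_of_mem_braggSet r k hj, hκ j]
  have hAmeas : MeasurableSet A := MeasurableSet.iUnion fun j => measurableSet_braggSet (Q j)
  unfold braggWeight
  calc κ * (μ A).toReal
      = ∫ ξ in A, κ ∂μ := by
        rw [setIntegral_const, Measure.real, smul_eq_mul, mul_comm]
    _ = ∫ ξ in A, K ξ ∂μ := setIntegral_congr_fun hAmeas fun ξ hξ => (hKA ξ hξ).symm
    _ ≤ ∫ ξ, K ξ ∂μ := setIntegral_le_integral hKint (ae_of_all _ hKnn)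
    _ = ∑ l, k l * (C (r l)).re := integral_cosKernel_eq μ hμ r k

omit [IsFiniteMeasure μ] in
/-- The total mass of a representing measure is `Re C(0)`. -/
theorem measureReal_univ_eq_re_zero
    (hμ : ∀ r : Fin d → ℤ, ∫ ξ, exp ((∑ i, (r i : ℝ) * ξ i : ℝ) * I) ∂μ = C r) :
    μ.real Set.univ = (C 0).re := by
  have h := hμ 0
  simp only [Pi.zero_apply, Int.cast_zero, zero_mul, Finset.sum_const_zero, Complex.ofReal_zero,
    Complex.exp_zero, integral_const] at h
  rw [← h]
  simp

/-- The trivial ceiling: every Bragg weight is at most the total mass `Re C(0)`. -/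
theorem braggWeight_le_re_zero
    (hμ : ∀ r : Fin d → ℤ, ∫ ξ, exp ((∑ i, (r i : ℝ) * ξ i : ℝ) * I) ∂μ = C r)
    {n : ℕ} (Q : Fin n → (Fin d → ℝ)) :
    braggWeight μ Q ≤ (C 0).re := by
  rw [← measureReal_univ_eq_re_zero μ hμ, Measure.real]
  exact ENNReal.toReal_mono (measure_ne_top μ _) (measure_mono (Set.subset_univ _))

/-- **Stage-2 interface / non-vacuity.**  A lattice function `C : ℤᵈ → ℂ` admits a finite representing
measure on `ℝᵈ` (the hypothesis `hμ` of every kernel ceiling) iff it is positive definite — Herglotz's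
theorem (`IsPositiveDefinite.exists_measure_integral_exp_eq`) and its easy converse
(`isPositiveDefinite_of_integral_exp_eq`), both landed in `Literature.Analysis.FunctionSpaces`.  So the
state-side obligation for a stripe-order ceiling is exactly: the (orbit-mean) correlation function of the
translation-invariant limit state `IsPositiveDefinite`. -/
theorem exists_representing_iff_isPositiveDefinite (C : (Fin d → ℤ) → ℂ) :
    (∃ μ : Measure (EuclideanSpace ℝ (Fin d)), IsFiniteMeasure μ ∧
      ∀ r : Fin d → ℤ, ∫ ξ, exp ((∑ i, (r i : ℝ) * ξ i : ℝ) * I) ∂μ = C r) ↔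
    Literature.Analysis.FunctionSpaces.IsPositiveDefinite C := by
  constructor
  · rintro ⟨μ, hfin, hμ⟩
    exact Literature.Analysis.FunctionSpaces.isPositiveDefinite_of_integral_exp_eq μ hμ
  · exact fun hC => hC.exists_measure_integral_exp_eq

/-- The kernel ceiling keyed on positive-definiteness: for a positive-definite `C` there is a representing
measure, and EVERY representing measure obeys `κ · braggWeight μ Q ≤ Σₗ kₗ · Re C(rₗ)`. -/
theorem kernelCeiling_of_isPositiveDefinite {C : (Fin d → ℤ) → ℂ}
    (hC : Literature.Analysis.FunctionSpaces.IsPositiveDefinite C)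
    {m : ℕ} (r : Fin m → (Fin d → ℤ)) (k : Fin m → ℝ) (hK : ∀ p : Fin d → ℝ, 0 ≤ cosKernel r k p)
    {n : ℕ} (Q : Fin n → (Fin d → ℝ)) (κ : ℝ) (hκ : ∀ j, cosKernel r k (Q j) = κ) :
    (∃ μ : Measure (EuclideanSpace ℝ (Fin d)), IsFiniteMeasure μ ∧
      ∀ r : Fin d → ℤ, ∫ ξ, exp ((∑ i, (r i : ℝ) * ξ i : ℝ) * I) ∂μ = C r) ∧
    ∀ μ : Measure (EuclideanSpace ℝ (Fin d)), IsFiniteMeasure μ →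
      (∀ r : Fin d → ℤ, ∫ ξ, exp ((∑ i, (r i : ℝ) * ξ i : ℝ) * I) ∂μ = C r) →
      κ * braggWeight μ Q ≤ ∑ l, k l * (C (r l)).re :=
  ⟨hC.exists_measure_integral_exp_eq, fun μ _ hμ => kernelCeiling_braggWeight_le μ hμ r k hK Q κ hκ⟩

end General

/-! ### §2. The square lattice: the two M3 kernels, their stars and gains -/

section Square

/-- `r·ξ` on `ℤ² × ℝ²` spelled out. -/
theorem sum_fin_two_dot (v : Fin 2 → ℤ) (ξ : Fin 2 → ℝ) :
    (∑ i, (v i : ℝ) * ξ i) = (v 0 : ℝ) * ξ 0 + (v 1 : ℝ) * ξ 1 := by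
  rw [Fin.sum_univ_two]

/-- CHARGE taps: `{0, ±e₁, ±e₂}` with weights `17/36, 1/12, 1/12, 1/12, 1/12` — the D₄-symmetrised
autocorrelation of the gen-6 charge taps `f₀ = 1/2`, `f_{e₁} = (1 − i)/3` (window words: docc via
`C(0)`, dens_nn via the four nearest-neighbour values). -/
def chargeTapVec : Fin 5 → (Fin 2 → ℤ) := ![![0, 0], ![1, 0], ![-1, 0], ![0, 1], ![0, -1]]

/-- CHARGE tap weights. -/
def chargeTapWt : Fin 5 → ℝ := ![17/36, 1/12, 1/12, 1/12, 1/12]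

/-- The charge kernel in closed form: `K̄_c(ξ) = 17/36 + (cos ξ₁ + cos ξ₂)/6`. -/
theorem chargeKernel_eq (ξ : Fin 2 → ℝ) :
    cosKernel chargeTapVec chargeTapWt ξ = 17/36 + (Real.cos (ξ 0) + Real.cos (ξ 1)) / 6 := by
  unfold cosKernel
  simp only [Fin.sum_univ_five, sum_fin_two_dot, chargeTapVec, chargeTapWt]
  simp [Real.cos_neg]
  ring

/-- `K̄_c ≥ 5/36 > 0` pointwise. -/
theorem chargeKernel_nonneg (ξ : Fin 2 → ℝ) : 0 ≤ cosKernel chargeTapVec chargeTapWt ξ := by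
  rw [chargeKernel_eq]
  have h0 := Real.neg_one_le_cos (ξ 0)
  have h1 := Real.neg_one_le_cos (ξ 1)
  linarith

/-- The charge-stripe star at `δ = 1/8` (period-8 charge stripes): `Q_c = (π/4, 0)` and its D₄ images
`(±π/4, 0), (0, ±π/4)` (four classes mod `2πℤ²`). -/
def chargeStar : Fin 4 → (Fin 2 → ℝ) := ![![π/4, 0], ![-(π/4), 0], ![0, π/4], ![0, -(π/4)]]

/-- `K̄_c` is constant on the charge star, with value `23/36 + √2/12`. -/
theorem chargeKernel_star (j : Fin 4) :
    cosKernel chargeTapVec chargeTapWt (chargeStar j) = 23/36 + Real.sqrt 2 / 12 := by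
  rw [chargeKernel_eq]
  fin_cases j <;> simp [chargeStar, Real.cos_pi_div_four, Real.cos_neg] <;> ring

/-- Rational floor of the charge star gain: `23/36 + √2/12 ≥ 0.75674` (`√2 ≥ 1.41421356`);
`4 × 0.75674 = 3.02696` is the star sum `23/9 + √2/3` of LRO-CEILING.md §3 rounded down. -/
theorem chargeStar_gain_ge : (0.75674 : ℝ) ≤ 23/36 + Real.sqrt 2 / 12 := by
  have h2 : (1.41421356 : ℝ) ≤ Real.sqrt 2 := by
    rw [Real.le_sqrt (by norm_num) (by norm_num)]
    norm_num
  linarith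

/-- SPIN taps: `{0, e₁, e₂, e₁+e₂, e₁−e₂}` with weights `1/4, −1/4, −1/4, 1/8, 1/8` — the autocorrelation
of the staggered plaquette taps `±1/4` written as an even cosine polynomial (window words: docc via
`C(0)`, spin_nn, spin_nnn). -/
def spinTapVec : Fin 5 → (Fin 2 → ℤ) := ![![0, 0], ![1, 0], ![0, 1], ![1, 1], ![1, -1]]

/-- SPIN tap weights. -/
def spinTapWt : Fin 5 → ℝ := ![1/4, -1/4, -1/4, 1/8, 1/8]

/-- The spin kernel in closed form: `K_s(ξ) = ¼(1 − cos ξ₁)(1 − cos ξ₂)`. -/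
theorem spinKernel_eq (ξ : Fin 2 → ℝ) :
    cosKernel spinTapVec spinTapWt ξ = (1 - Real.cos (ξ 0)) * (1 - Real.cos (ξ 1)) / 4 := by
  unfold cosKernel
  simp only [Fin.sum_univ_five, sum_fin_two_dot, spinTapVec, spinTapWt]
  simp [Real.cos_add, sub_eq_add_neg]
  ring

/-- `K_s ≥ 0` pointwise. -/
theorem spinKernel_nonneg (ξ : Fin 2 → ℝ) : 0 ≤ cosKernel spinTapVec spinTapWt ξ := by
  rw [spinKernel_eq]
  have h0 := Real.cos_le_one (ξ 0)
  have h1 := Real.cos_le_one (ξ 1)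
  have : 0 ≤ (1 - Real.cos (ξ 0)) * (1 - Real.cos (ξ 1)) := mul_nonneg (by linarith) (by linarith)
  linarith

/-- The spin-stripe star at `δ = 1/8` (period-16 spin stripes): `Q_s = (7π/8, π)` and its D₄ images
`(±7π/8, π), (π, ±7π/8)` (four classes mod `2πℤ²`). -/
def spinStar : Fin 4 → (Fin 2 → ℝ) :=
  ![![7 * π / 8, π], ![-(7 * π / 8), π], ![π, 7 * π / 8], ![π, -(7 * π / 8)]]

/-- `cos(7π/8) = −cos(π/8)`. -/
theorem cos_seven_pi_div_eight : Real.cos (7 * π / 8) = -Real.cos (π / 8) := by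
  rw [show 7 * π / 8 = π - π / 8 by ring, Real.cos_pi_sub]

/-- `K_s` is constant on the spin star, with value `(1 + cos(π/8))/2`. -/
theorem spinKernel_star (j : Fin 4) :
    cosKernel spinTapVec spinTapWt (spinStar j) = (1 + Real.cos (π / 8)) / 2 := by
  rw [spinKernel_eq]
  fin_cases j <;> simp [spinStar, Real.cos_neg, cos_seven_pi_div_eight] <;> ring

/-- `K_s(π,π) = 1` (the Néel point). -/
theorem spinKernel_pi_pi : cosKernel spinTapVec spinTapWt ![π, π] = 1 := by
  rw [spinKernel_eq]
  simp
  norm_num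

/-- Rational floor of the spin star gain: `(1 + cos(π/8))/2 ≥ 0.9619397`
(`cos(π/8) = √(2+√2)/2 ≥ 0.9238795`); `4 × 0.9619397` is the star sum `2(1 + cos(π/8)) = 3.8477590…`
of LRO-CEILING.md §3 rounded down. -/
theorem spinStar_gain_ge : (0.9619397 : ℝ) ≤ (1 + Real.cos (π / 8)) / 2 := by
  have h2 : (1.41421356 : ℝ) ≤ Real.sqrt 2 := by
    rw [Real.le_sqrt (by norm_num) (by norm_num)]
    norm_num
  have h3 : (1.847759 : ℝ) ≤ Real.sqrt (2 + Real.sqrt 2) := by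
    rw [Real.le_sqrt (by norm_num) (by positivity)]
    nlinarith
  rw [Real.cos_pi_div_eight]
  linarith

end Square

end Summit.Ventures.CertifiedManyBodySolver.Observables

end
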